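import Summits.RiemannHypothesis.RiemannHypothesis.Theses.SpectralTrace
import Summits.RiemannHypothesis.RiemannHypothesis.Theorems.WindowStep.Negative.Collapse
import Summits.RiemannHypothesis.RiemannHypothesis.Theorems.SpectralTraceSpectralThesisSameWindow
import Summits.RiemannHypothesis.RiemannHypothesis.Theorems.SpectralTraceSpectralThesisBreakingWindow
import Summits.RiemannHypothesis.RiemannHypothesis.Theorems.SpectralTraceWindowCompactness
import HarnessLib

/-!
# Strategy sketch (companion of `STRATEGY-CENSUS.md`) — crux `SpectralThesis` (stmt-RiemannHypothesis-0187)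

Crux-strategist seat `planner-cstrat-stmt-RiemannHypothesis-0187-p1-0` (wall-breaker, gen 1), 2026-08-17.
Everything here is kernel-checked and sorry-free; it types the census's Decomposition / Strengthen /
Negation attempts so that the verdict "no leverage" is a theorem-shaped statement, not an adjective.

* §0 THE IRON LAW, ABSTRACTLY. `residual_iff_summit`: if `T → S₂` and `S₁ → S₂ → T`, then as soon as
  `S₁` is PROVED the residual `S₂` is `↔ T`. `strengthen_iff_summit`: an RH-implied strengthening `S⁺`
  of an RH-equivalent `X` is itself `↔ RH`. (With `T = RH`, `X = SpectralThesis ↔ RH`,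
  `spectralThesis_iff_riemannHypothesis'`.) So a decomposition of `X` has "teeth" only until one of its
  conjuncts is proved, and a strengthening has teeth only if it is NOT implied by RH (a bet).
* §1 DECOMPOSITION D1 (the route's own): `spectralThesis_of_binders : WindowTraceArch → WindowStep → X`
  (from `Collapse.lean`), with `WindowStep ↔ (WindowTraceArch → X)` already landed — the engine is the
  crux conditioned on the seed.
* §2 DECOMPOSITION D2 (arithmetic type of the step): `StepPrimePow`, `StepComposite`,
  `windowStep_iff_stepPrimePow_and_stepComposite`, the glue
  `spectralThesis_of_arch_of_stepPrimePow_of_stepComposite`, both children RH-implied, the RH-FREE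
  disjunction `stepPrimePow_or_stepComposite` (at least one child is TRUE outright), and the dichotomy
  `split_dichotomy_of_not_riemannHypothesis`: under `¬ RH` and the seed EXACTLY ONE child fails, namely
  the one whose arithmetic type is that of the breaking integer `n* = ⌊e^{A*}⌋` — so neither child is
  RH-equivalent by any theorem that does not decide the type of `n*`, and neither has a mechanism the
  other lacks (the census's "lint-honest, difficulty-dishonest").
* §3 NEGATION, typed: `not_spectralThesis_iff_breakingWindow` — a counterexample to `X` is exactly a
  positive real `A*` (the breaking window), equivalently `¬ RH`.
-/

noncomputable section

set_option linter.dupNamespace false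

open Complex Set

namespace Summit.RiemannHypothesis.RiemannHypothesis.Cruxes.SpectralThesis.StrategySketch

open Literature.NumberTheory.LFunctions
open Summit.RiemannHypothesis.RiemannHypothesis.Theses.SpectralTrace
open Summit.RiemannHypothesis.RiemannHypothesis.Theorems
open Summit.RiemannHypothesis.RiemannHypothesis.Theorems.WindowStep.Negative

/-- File-local spelling of `Trace(A)` (closed window), as in `Collapse.lean`. -/
local notation3 "WTrace " A:max => ∃ (ι : Type) (γ : ι → ℝ), ∀ g : ℝ → ℂ, IsWeilTest g →
  tsupport g ⊆ Set.Icc (-A) A →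
    HasSum (fun i => weilMellin g (1 / 2 + (γ i : ℂ) * I)) (weilFunctional g)

/-! ## §0 The iron law, abstractly -/

/-- **Decomposition collapse.** If the summit `T` implies the conjunct `S₂` and the glue
`S₁ → S₂ → T` holds, then once `S₁` is proved the residual conjunct is equivalent to the summit.
[folklore] -/
theorem residual_iff_summit {S₁ S₂ T : Prop} (hT : T → S₂) (hglue : S₁ → S₂ → T) (h₁ : S₁) :
    (S₂ ↔ T) :=
  ⟨hglue h₁, hT⟩

/-- **Strengthening collapse.** If `X ↔ T`, `S⁺ → X` and `T → S⁺` (the strengthening is implied by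
the summit), then `S⁺ ↔ T`: an RH-implied strengthening of an RH-equivalent statement is RH again.
[folklore] -/
theorem strengthen_iff_summit {S X T : Prop} (hXT : X ↔ T) (hSX : S → X) (hTS : T → S) :
    (S ↔ T) :=
  ⟨fun h => hXT.1 (hSX h), hTS⟩

/-- The crux is the summit (re-export of Disproof §1 / `WindowCompactness` calibration):
`X ↔ RH`. [folklore] -/
theorem spectralThesis_iff_riemannHypothesis' : SpectralThesis ↔ _root_.RiemannHypothesis :=
  ⟨fun ⟨_, _, h⟩ => riemannHypothesis_of_ladder fun _ _ => ⟨_, _, fun g hg _ => h g hg⟩,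
    spectralThesis_of_riemannHypothesis⟩

/-! ## §1 Decomposition D1 — the route's binders -/

/-- **D1.** `X` from the route's two binders (the deciding theorem's shape): seed and step give the
ladder, the ladder gives `X`. [folklore] -/
theorem spectralThesis_of_binders (hArch : WindowTraceArch) (hStep : WindowStep) : SpectralThesis :=
  (windowStep_iff_windowTraceArch_imp_spectralThesis.1 hStep) hArch

/-- D1 collapses: given the seed, the engine IS the crux (`Collapse.lean`, restated). [folklore] -/
theorem windowStep_iff_spectralThesis_of_windowTraceArch (hArch : WindowTraceArch) :
    WindowStep ↔ SpectralThesis :=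
  ⟨fun hStep => spectralThesis_of_binders hArch hStep,
    fun hX => windowStep_iff_windowTraceArch_imp_spectralThesis.2 fun _ => hX⟩

/-! ## §2 Decomposition D2 — the arithmetic type of the step -/

/-- **D2, child 1.** The step at PRIME-POWER rungs: for `n = p^k`, `Trace(log n) → Trace(log (n+1))`
(the collar carries the new spike pair `-(log p/√n)(δ_{log n} + δ_{-log n})`). [folklore] -/
def StepPrimePow : Prop :=
  ∀ n : ℕ, 2 ≤ n → IsPrimePow n → (WTrace (Real.log (n : ℝ))) → WTrace (Real.log ((n : ℝ) + 1))

/-- **D2, child 2.** The step at COMPOSITE (non-prime-power) rungs: the collar defect is smooth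
(polar + archimedean densities only). [folklore] -/
def StepComposite : Prop :=
  ∀ n : ℕ, 2 ≤ n → ¬ IsPrimePow n → (WTrace (Real.log (n : ℝ))) → WTrace (Real.log ((n : ℝ) + 1))

/-- The step is exactly the conjunction of its two arithmetic halves. [folklore] -/
theorem windowStep_iff_stepPrimePow_and_stepComposite :
    WindowStep ↔ StepPrimePow ∧ StepComposite := by
  constructor
  · intro h
    exact ⟨fun n hn _ => h n hn, fun n hn _ => h n hn⟩
  · rintro ⟨hP, hC⟩ n hn
    by_cases hpp : IsPrimePow n
    · exact hP n hn hpp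
    · exact hC n hn hpp

/-- **D2 glue** (`Sub₁ → Sub₂ → Sub₃ → X`): seed, prime-power steps and composite steps give `X`.
[folklore] -/
theorem spectralThesis_of_arch_of_stepPrimePow_of_stepComposite (hArch : WindowTraceArch)
    (hP : StepPrimePow) (hC : StepComposite) : SpectralThesis :=
  spectralThesis_of_binders hArch (windowStep_iff_stepPrimePow_and_stepComposite.2 ⟨hP, hC⟩)

/-- Child 1 is RH-implied. [folklore] -/
theorem stepPrimePow_of_riemannHypothesis (hRH : _root_.RiemannHypothesis) : StepPrimePow :=
  fun _ _ _ _ => windowTrace_of_riemannHypothesis hRH _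

/-- Child 2 is RH-implied. [folklore] -/
theorem stepComposite_of_riemannHypothesis (hRH : _root_.RiemannHypothesis) : StepComposite :=
  fun _ _ _ _ => windowTrace_of_riemannHypothesis hRH _

/-- **RH-free: at least one child is TRUE.** Either RH (then both), or the ladder has a breaking
window `A*` (`exists_breakingWindow_of_not_riemannHypothesis`) and the integer step fails ONLY at
`n* = ⌊e^{A*}⌋` (`failing_step_eq_floor_exp_breakingWindow`): if `n*` is a prime power every
composite step holds, otherwise every prime-power step holds. [folklore] -/
theorem stepPrimePow_or_stepComposite : StepPrimePow ∨ StepComposite := by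
  by_cases hRH : _root_.RiemannHypothesis
  · exact Or.inl (stepPrimePow_of_riemannHypothesis hRH)
  · obtain ⟨Astar, _, hA⟩ := SpectralThesis.Sketch.exists_breakingWindow_of_not_riemannHypothesis hRH
    by_cases hpp : IsPrimePow ⌊Real.exp Astar⌋₊
    · refine Or.inr fun n hn hnpp hrung => ?_
      by_contra hfail
      have hEq : n = ⌊Real.exp Astar⌋₊ :=
        (SpectralThesis.Sketch.failing_step_eq_floor_exp_breakingWindow hA hn).1 ⟨hrung, hfail⟩
      have : IsPrimePow n := by rw [hEq]; exact hpp
      exact hnpp this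
    · refine Or.inl fun n hn hnpp hrung => ?_
      by_contra hfail
      have hEq : n = ⌊Real.exp Astar⌋₊ :=
        (SpectralThesis.Sketch.failing_step_eq_floor_exp_breakingWindow hA hn).1 ⟨hrung, hfail⟩
      have : IsPrimePow ⌊Real.exp Astar⌋₊ := by rw [← hEq]; exact hnpp
      exact hpp this

/-- **D2 dichotomy (why neither child has a mechanism the other lacks).** If RH fails and the seed
`WindowTraceArch` holds, there is ONE integer `n ≥ 2` (the breaking integer `⌊e^{A*}⌋`) such that:
if `n` is a prime power then `StepPrimePow` fails and `StepComposite` holds, and if not then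
`StepPrimePow` holds and `StepComposite` fails. So each child alone is consistent with `¬ RH`, the pair
is `WindowStep ↔ (WindowTraceArch → RH)`, and deciding which child carries RH is deciding the
arithmetic type of the breaking integer. [folklore] -/
theorem split_dichotomy_of_not_riemannHypothesis (hnRH : ¬ _root_.RiemannHypothesis)
    (hArch : WindowTraceArch) :
    ∃ n : ℕ, 2 ≤ n ∧ (IsPrimePow n → ¬ StepPrimePow ∧ StepComposite) ∧
      (¬ IsPrimePow n → StepPrimePow ∧ ¬ StepComposite) := by
  obtain ⟨Astar, h0, hA⟩ := SpectralThesis.Sketch.exists_breakingWindow_of_not_riemannHypothesis hnRH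
  have hlog : Real.log 2 ≤ Astar :=
    SpectralThesis.Sketch.log_two_le_breakingWindow_of_windowTraceArch h0 hA hArch
  have h2 : (2 : ℝ) ≤ Real.exp Astar := by
    have := Real.exp_le_exp.2 hlog
    rwa [Real.exp_log (by norm_num : (0 : ℝ) < 2)] at this
  have hn : 2 ≤ ⌊Real.exp Astar⌋₊ := Nat.le_floor (by exact_mod_cast h2)
  have hfail := (SpectralThesis.Sketch.failing_step_eq_floor_exp_breakingWindow hA hn).2 rfl
  refine ⟨⌊Real.exp Astar⌋₊, hn, fun hpp => ⟨fun hP => hfail.2 (hP _ hn hpp hfail.1), ?_⟩,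
    fun hnpp => ⟨?_, fun hC => hfail.2 (hC _ hn hnpp hfail.1)⟩⟩
  · intro m hm hmpp hrung
    by_contra hf
    have hEq : m = ⌊Real.exp Astar⌋₊ :=
      (SpectralThesis.Sketch.failing_step_eq_floor_exp_breakingWindow hA hm).1 ⟨hrung, hf⟩
    exact hmpp (by rw [hEq]; exact hpp)
  · intro m hm hmpp hrung
    by_contra hf
    have hEq : m = ⌊Real.exp Astar⌋₊ :=
      (SpectralThesis.Sketch.failing_step_eq_floor_exp_breakingWindow hA hm).1 ⟨hrung, hf⟩
    exact hnpp (by rw [← hEq]; exact hmpp)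

/-- Corollary: given the seed, the residual of D2 is RH split by an undecided arithmetic predicate —
`(StepPrimePow ∧ StepComposite) ↔ RH`. [folklore] -/
theorem stepPrimePow_and_stepComposite_iff_riemannHypothesis (hArch : WindowTraceArch) :
    (StepPrimePow ∧ StepComposite) ↔ _root_.RiemannHypothesis := by
  rw [← windowStep_iff_stepPrimePow_and_stepComposite,
    windowStep_iff_windowTraceArch_imp_riemannHypothesis]
  exact ⟨fun h => h hArch, fun h _ => h⟩

/-! ## §3 Negation, typed -/

/-- **The shape of a counterexample to `X`.** `X` fails iff the real-spectrum ladder has a breaking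
window `A* > 0` (open rungs hold exactly for `A ≤ A*`) — iff `¬ RH`. A disproof of the crux is a
located disproof of the Riemann hypothesis; nothing weaker refutes it. [folklore] -/
theorem not_spectralThesis_iff_breakingWindow :
    ¬ SpectralThesis ↔ ∃ Astar : ℝ, 0 < Astar ∧ ∀ A : ℝ, 0 < A →
      ((∃ (ι : Type) (γ : ι → ℝ), ∀ g : ℝ → ℂ, IsWeilTest g → tsupport g ⊆ Set.Ioo (-A) A →
        HasSum (fun i => weilMellin g (1 / 2 + (γ i : ℂ) * I)) (weilFunctional g)) ↔ A ≤ Astar) := by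
  rw [spectralThesis_iff_riemannHypothesis'.not]
  exact SpectralThesis.Sketch.stub_breakingWindow

end Summit.RiemannHypothesis.RiemannHypothesis.Cruxes.SpectralThesis.StrategySketch

end
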